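import Literature.Analysis.FluidPDE.MillerMiddleEigenvalueGronwall
import Summits.NavierStokesRegularity.NavierStokesRegularity.Theorems.TypeICertificateLadderTargetStrainCubeIdentities
import HarnessLib

/-!
# Crux `Target` = `TypeICertificateLadder.NoTypeIBlowup` (stmt-NavierStokesRegularity-1217), line
# `depletion-ladder`: THE DEPLETION CONSTANT `κ = (√3 + √6)/9 < 1/2` (stub S1 in the Tao-slice class)

`--supports stmt-NavierStokesRegularity-1217` (sixth file of the seat's S1/RUNG-TWO series).

**Theorem (`abs_integral_stretching_le_strainCube`).** For a `C^∞` divergence-free `v : ℝ³ → ℝ³`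
with `|v| ≤ M`, `‖Dv‖ ≤ B` and `D⁰v, D¹v, D²v ∈ L²` (the slice class of the rung glue
`rung_of_flowwiseDepletion`), `ω = curl v`:

  `|∫ ⟪ω, Dv ω⟫| ≤ ((√3 + √6)/9) · M · ‖ω‖₂ · ‖∇ω‖₂`,   `(√3 + √6)/9 = 0.4646… < 1/2`.

This is the line's stub S1 `stub_depletionBelowHalf` (`∃ κ < 1/2, StretchingDepletion κ`) on the
slice class (the registered class — `C²`, bounded, no decay of `v` — differs only by a density
argument; the rung machinery uses exactly the slice class). Cauchy–Schwarz gives `κ = 1`; every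
`κ < (√6+√2)/4 ≈ 0.966` is a rung above the kernel-checked ceiling `√6 − √2 ≈ 1.035` of the whole
`L^q`-vorticity budget family (`RungReynoldsOneNegative.lt_ceiling_of_budgetCloses`); `κ < 1/2` is
RUNG TWO (`C < 2`), indeed every `C < 9/(√3+√6) ≈ 2.152` (sequel file).

**Proof.** (1) Betchov–Miller: `⟪ω, Dv ω⟫ = 4 det Dv − 4 det S` pointwise (first file) and
`∫ det Dv = 0` (tree `integral_det_fderiv_eq_zero`, determinants are null Lagrangians), so
`∫⟪ω,Dvω⟫ = −4∫det S`; (2) Miller's `|4 det S| ≤ (2√6/9)|S|³` (tree `Miller2019.neg_four_mul_det_le`);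
(3) the NEW strain-cube interpolation `∫|S|³ ≤ M(½‖Δv‖₂‖S‖₂ + ‖S‖₂‖∇S‖₂)` (fourth file);
(4) `‖S‖₂² = ½‖ω‖₂²`, `‖∇S‖₂² = ½‖∇ω‖₂²`, `‖Δv‖₂ = ‖∇ω‖₂` (fifth file). Constant:
`(2√6/9)·(1/(2√2) + 1/2) = (√3+√6)/9`.

WHAT THIS IS NOT: a kinematic inequality (no Navier–Stokes); the rung is the sequel file; the
registered S1 class (no decay) is not literally covered.

References: R. Betchov, J. Fluid Mech. 1 (1956) 497–504; E. Miller, Arch. Ration. Mech. Anal. 237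
(2020) (arXiv:1710.05569), Prop. 4.8 / Thm. 1.6; L. C. Evans, PDE, §8.1.4.b. [cite: Miller2019, Prop. 4.8]
-/

noncomputable section

open Set Function Filter Topology MeasureTheory Finset
open scoped RealInnerProductSpace ENNReal NNReal Laplacian ContDiff
open Literature.Analysis.FluidPDE

namespace Summit.NavierStokesRegularity.NavierStokesRegularity.Theorems.DepletionLadder.StrainCube

-- the problem directory repeats the summit name (`NavierStokesRegularity/NavierStokesRegularity`)
set_option linter.dupNamespace false

open Summit.NavierStokesRegularity.NavierStokesRegularity.Theorems.RungReynoldsOne.WeightedSlice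

variable {v : EuclideanSpace ℝ (Fin 3) → EuclideanSpace ℝ (Fin 3)}
  {s : Fin 3 → Fin 3 → EuclideanSpace ℝ (Fin 3) → ℝ}

/-! ## The stretching density in coordinates -/

/-- `⟪x, y⟫ = Σᵢ xᵢ yᵢ` on `ℝ³`. [folklore] -/
theorem inner_eq_sum_mul (x y : EuclideanSpace ℝ (Fin 3)) : ⟪x, y⟫ = ∑ i, x i * y i := by
  rw [EuclideanSpace.inner_eq_star_dotProduct, dotProduct]
  simp [mul_comm]

/-- **The stretching density is `Σᵢⱼ ωᵢ gᵢⱼ ωⱼ`** with `gᵢⱼ = ∂ⱼvᵢ`, `ω = curl v`. [folklore] -/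
theorem stretching_eq_sum (hv : ContDiff ℝ ∞ v) (x : EuclideanSpace ℝ (Fin 3)) :
    ⟪curl v x, fderiv ℝ v x (curl v x)⟫ =
      ∑ i, ∑ j, curl v x i * pderiv j (fun y => v y i) x * curl v x j := by
  rw [inner_eq_sum_mul]
  refine Finset.sum_congr rfl fun i _ => ?_
  rw [euclidean_fderiv_apply_comp ((hv.differentiable (by simp)) x), fderiv_apply_eq_sum_mul_pderiv,
    Finset.mul_sum]
  exact Finset.sum_congr rfl fun j _ => by ring

/-- The velocity gradient is trace free: `Σᵢ ∂ᵢvᵢ = 0`, as `g₀₀ + g₁₁ + g₂₂ = 0`. [folklore] -/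
theorem grad_trace_eq_zero (hv : ContDiff ℝ ∞ v) (hdiv : VectorCalculus.IsDivFree v)
    (x : EuclideanSpace ℝ (Fin 3)) :
    pderiv 0 (fun y => v y 0) x + pderiv 1 (fun y => v y 1) x + pderiv 2 (fun y => v y 2) x = 0 := by
  have h := hdiv.sum_pderiv_comp_eq_zero (hv.differentiable (by simp)) x
  simpa [Fin.sum_univ_three] using h

/-- `det (gᵢⱼ) = det Dv(x)`. [folklore] -/
theorem det_grad_eq (hv : ContDiff ℝ ∞ v) (x : EuclideanSpace ℝ (Fin 3)) :
    (Matrix.of fun i j => pderiv j (fun y => v y i) x).det =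
      LinearMap.det (fderiv ℝ v x : EuclideanSpace ℝ (Fin 3) →ₗ[ℝ] EuclideanSpace ℝ (Fin 3)) := by
  have h : (Matrix.of fun i j => pderiv j (fun y => v y i) x) =
      stdMatrix (fderiv ℝ v x : EuclideanSpace ℝ (Fin 3) →ₗ[ℝ] EuclideanSpace ℝ (Fin 3)) := by
    ext i j
    rw [Matrix.of_apply, grad_eq_stdMatrix hv]
  rw [h]
  exact LinearMap.det_toMatrix _ _

/-- **Pointwise Betchov–Miller bound**: `|⟪ω, Dv ω⟫ − 4 det Dv| ≤ (2√6/9) |S|² √(|S|²)`. [folklore] -/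
theorem abs_stretching_sub_four_det_le (hv : ContDiff ℝ ∞ v) (hdiv : VectorCalculus.IsDivFree v)
    (hs : ∀ i j y, s i j y = (pderiv j (fun z => v z i) y + pderiv i (fun z => v z j) y) / 2)
    (x : EuclideanSpace ℝ (Fin 3)) :
    |⟪curl v x, fderiv ℝ v x (curl v x)⟫ -
        4 * LinearMap.det (fderiv ℝ v x : EuclideanSpace ℝ (Fin 3) →ₗ[ℝ] EuclideanSpace ℝ (Fin 3))| ≤
      (2 / 9) * Real.sqrt 6 * ((∑ i, ∑ j, s i j x ^ 2) * Real.sqrt (∑ i, ∑ j, s i j x ^ 2)) := by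
  obtain ⟨h0, h1, h2⟩ := curl_apply_eq hv x
  have htr := grad_trace_eq_zero hv hdiv x
  rw [stretching_eq_sum hv, ← det_grad_eq hv]
  have hup := vortStretch_le_four_det_add (fun i j => pderiv j (fun y => v y i) x) (fun i j => s i j x)
    (fun k => curl v x k) (fun i j => hs i j x) h0 h1 h2 htr
  have hlo := four_det_sub_le_vortStretch (fun i j => pderiv j (fun y => v y i) x) (fun i j => s i j x)
    (fun k => curl v x k) (fun i j => hs i j x) h0 h1 h2 htr
  rw [abs_le]
  constructor <;> linarith

/-! ## Integration: `|∫⟪ω, Dv ω⟫| ≤ (2√6/9) ∫ |S|³` -/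

/-- **Betchov–Miller on `ℝ³`**: for a `C^∞` divergence-free `v` with `|v| ≤ M`, `‖Dv‖ ≤ B`,
`D¹v ∈ L²`: `|∫⟪ω, Dv ω⟫| ≤ (2√6/9) ∫ |S|²√(|S|²)` (`∫ det Dv = 0`). [folklore] -/
theorem abs_integral_stretching_le_integral_cube (hv : ContDiff ℝ ∞ v) (hdiv : VectorCalculus.IsDivFree v)
    {M B : ℝ} (hM : ∀ x, ‖v x‖ ≤ M) (hB : ∀ x, ‖fderiv ℝ v x‖ ≤ B)
    (h1 : ∫⁻ x, ‖iteratedFDeriv ℝ 1 v x‖ₑ ^ 2 < ⊤)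
    (hs : ∀ i j y, s i j y = (pderiv j (fun z => v z i) y + pderiv i (fun z => v z j) y) / 2) :
    |∫ x, ⟪curl v x, fderiv ℝ v x (curl v x)⟫| ≤
      (2 / 9) * Real.sqrt 6 * ∫ x, (∑ i, ∑ j, s i j x ^ 2) * Real.sqrt (∑ i, ∑ j, s i j x ^ 2) := by
  have hv1 : ContDiff ℝ 1 v := hv.of_le (by norm_cast)
  have hB0 : 0 ≤ B := (norm_nonneg _).trans (hB 0)
  have hsC := contDiff_sym hv hs
  have T1eq : ∀ x, ‖fderiv ℝ v x‖ = ‖iteratedFDeriv ℝ 1 v x‖ := fun x => norm_fderiv_eq_norm_iteratedFDeriv_one x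
  set J : EuclideanSpace ℝ (Fin 3) → ℝ := fun x => ⟪curl v x, fderiv ℝ v x (curl v x)⟫ with hJ
  set dt : EuclideanSpace ℝ (Fin 3) → ℝ := fun x =>
    LinearMap.det (fderiv ℝ v x : EuclideanSpace ℝ (Fin 3) →ₗ[ℝ] EuclideanSpace ℝ (Fin 3)) with hdt
  set c3 : EuclideanSpace ℝ (Fin 3) → ℝ := fun x =>
    (∑ i, ∑ j, s i j x ^ 2) * Real.sqrt (∑ i, ∑ j, s i j x ^ 2) with hc3
  -- `∫ det Dv = 0`
  have hdet0 : ∫ x, dt x = 0 := integral_det_fderiv_eq_zero hv hM hB h1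
  -- integrability of `J`, `det`, `|S|³`
  have cJ : Continuous J := (continuous_curl hv1).inner
    ((hv1.continuous_fderiv one_ne_zero).clm_apply (continuous_curl hv1))
  have iJ : Integrable J := by
    refine integrable_of_le_iteratedFDeriv_mul hv h1 h1 cJ (‖curlCLM‖ ^ 2 * B) fun x => ?_
    have hc := norm_curl_le v x
    rw [T1eq] at hc
    have hB' : ‖fderiv ℝ v x‖ ≤ B := hB x
    calc |J x| ≤ ‖curl v x‖ * ‖fderiv ℝ v x (curl v x)‖ := abs_real_inner_le_norm _ _
      _ ≤ ‖curl v x‖ * (‖fderiv ℝ v x‖ * ‖curl v x‖) :=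
          mul_le_mul_of_nonneg_left ((fderiv ℝ v x).le_opNorm _) (norm_nonneg _)
      _ ≤ (‖curlCLM‖ * ‖iteratedFDeriv ℝ 1 v x‖) * (B * (‖curlCLM‖ * ‖iteratedFDeriv ℝ 1 v x‖)) :=
          mul_le_mul hc (mul_le_mul hB' hc (norm_nonneg _) hB0) (by positivity) (by positivity)
      _ = ‖curlCLM‖ ^ 2 * B * ‖iteratedFDeriv ℝ 1 v x‖ * ‖iteratedFDeriv ℝ 1 v x‖ := by ring
  have cc3 : Continuous c3 := by
    have cq : Continuous fun x => ∑ i, ∑ j, s i j x ^ 2 := continuous_finsetSum _ fun i _ =>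
      continuous_finsetSum _ fun j _ => ((hsC i j).continuous).pow 2
    exact cq.mul (Real.continuous_sqrt.comp cq)
  have ic3 : Integrable c3 := by
    refine integrable_of_le_iteratedFDeriv_mul hv h1 h1 cc3 (27 * B) fun x => ?_
    have hq0 : 0 ≤ ∑ i, ∑ j, s i j x ^ 2 := sumSq_nonneg (s := s) x
    rw [hc3]; simp only
    rw [abs_mul, abs_of_nonneg hq0, abs_of_nonneg (Real.sqrt_nonneg _)]
    have hB' : ‖iteratedFDeriv ℝ 1 v x‖ ≤ B := by rw [← T1eq]; exact hB x
    have T0 : 0 ≤ ‖iteratedFDeriv ℝ 1 v x‖ := norm_nonneg _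
    calc (∑ i, ∑ j, s i j x ^ 2) * Real.sqrt (∑ i, ∑ j, s i j x ^ 2)
        ≤ (9 * ‖iteratedFDeriv ℝ 1 v x‖ ^ 2) * (3 * ‖iteratedFDeriv ℝ 1 v x‖) :=
          mul_le_mul (sumSq_sym_le hv hs x) (sqrt_sumSq_sym_le hv hs x) (Real.sqrt_nonneg _) (by positivity)
      _ = (27 * ‖iteratedFDeriv ℝ 1 v x‖ * ‖iteratedFDeriv ℝ 1 v x‖) * ‖iteratedFDeriv ℝ 1 v x‖ := by ring
      _ ≤ (27 * ‖iteratedFDeriv ℝ 1 v x‖ * ‖iteratedFDeriv ℝ 1 v x‖) * B :=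
          mul_le_mul_of_nonneg_left hB' (by positivity)
      _ = 27 * B * ‖iteratedFDeriv ℝ 1 v x‖ * ‖iteratedFDeriv ℝ 1 v x‖ := by ring
  have idt : Integrable dt := by
    -- `4|det| ≤ |J| + c |S|³` and `J`, `|S|³` integrable
    have cdt : Continuous dt := ContinuousLinearMap.continuous_det.comp (hv1.continuous_fderiv one_ne_zero)
    refine ((iJ.abs.add (ic3.const_mul ((2 / 9) * Real.sqrt 6))).const_mul (1 / 4)).mono'
      cdt.aestronglyMeasurable (Eventually.of_forall fun x => ?_)
    have h := abs_stretching_sub_four_det_le hv hdiv hs x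
    rw [Real.norm_eq_abs]
    change |dt x| ≤ 1 / 4 * (|J x| + (2 / 9) * Real.sqrt 6 * c3 x)
    change |J x - 4 * dt x| ≤ (2 / 9) * Real.sqrt 6 * c3 x at h
    rw [abs_le] at h
    have hJ1 := le_abs_self (J x)
    have hJ2 := neg_abs_le (J x)
    rw [abs_le]
    constructor <;> linarith [h.1, h.2]
  -- pointwise two-sided bound, integrated
  have hup : ∫ x, J x ≤ (2 / 9) * Real.sqrt 6 * ∫ x, c3 x := by
    have iR : Integrable fun x => 4 * dt x + (2 / 9) * Real.sqrt 6 * c3 x :=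
      (idt.const_mul 4).add (ic3.const_mul _)
    have h := integral_mono iJ iR (fun x => by
      have h := (abs_le.1 (abs_stretching_sub_four_det_le hv hdiv hs x)).2
      change J x ≤ 4 * dt x + (2 / 9) * Real.sqrt 6 * c3 x
      change J x - 4 * dt x ≤ (2 / 9) * Real.sqrt 6 * c3 x at h
      linarith)
    rw [integral_add (idt.const_mul 4) (ic3.const_mul _), integral_const_mul, integral_const_mul,
      hdet0] at h
    linarith
  have hlo : -((2 / 9) * Real.sqrt 6 * ∫ x, c3 x) ≤ ∫ x, J x := by
    have iR : Integrable fun x => 4 * dt x - (2 / 9) * Real.sqrt 6 * c3 x :=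
      (idt.const_mul 4).sub (ic3.const_mul _)
    have h := integral_mono iR iJ (fun x => by
      have h := (abs_le.1 (abs_stretching_sub_four_det_le hv hdiv hs x)).1
      change 4 * dt x - (2 / 9) * Real.sqrt 6 * c3 x ≤ J x
      change -((2 / 9) * Real.sqrt 6 * c3 x) ≤ J x - 4 * dt x at h
      linarith)
    rw [integral_sub (idt.const_mul 4) (ic3.const_mul _), integral_const_mul, integral_const_mul,
      hdet0] at h
    linarith
  exact abs_le.2 ⟨hlo, hup⟩

/-! ## The depletion constant -/

/-- The constant bookkeeping: `(2√6/9)(½ √W √(Z/2) + √(Z/2) √(W/2)) = ((√3+√6)/9) √Z √W`. [folklore] -/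
theorem depletion_constant_eq (Z W : ℝ) :
    (2 / 9) * Real.sqrt 6 * ((1 / 2) * Real.sqrt W * Real.sqrt ((1 / 2) * Z) +
        Real.sqrt ((1 / 2) * Z) * Real.sqrt ((1 / 2) * W)) =
      (Real.sqrt 3 + Real.sqrt 6) / 9 * Real.sqrt Z * Real.sqrt W := by
  have h12 : Real.sqrt (1 / 2) * Real.sqrt (1 / 2) = 1 / 2 := Real.mul_self_sqrt (by norm_num)
  have h63 : Real.sqrt 6 * Real.sqrt (1 / 2) = Real.sqrt 3 := by
    rw [← Real.sqrt_mul (by norm_num)]; norm_num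
  rw [Real.sqrt_mul (by norm_num : (0:ℝ) ≤ 1 / 2) Z, Real.sqrt_mul (by norm_num : (0:ℝ) ≤ 1 / 2) W]
  linear_combination (1 / 9 * Real.sqrt Z * Real.sqrt W) * h63 +
    (2 / 9 * Real.sqrt 6 * Real.sqrt Z * Real.sqrt W) * h12

/-- **THE DEPLETION CONSTANT (stub S1 of line `depletion-ladder` in the Tao-slice class).**
For a `C^∞` divergence-free field `v : ℝ³ → ℝ³` with `|v| ≤ M`, `‖Dv‖ ≤ B` and
`D⁰v, D¹v, D²v ∈ L²`, the vortex-stretching integral obeys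
`|∫⟪curl v, Dv (curl v)⟫| ≤ ((√3+√6)/9) · M · √(∫‖curl v‖²) · √(∫|∇ curl v|²_F)`,
with `(√3+√6)/9 ≈ 0.4646 < 1/2` (Cauchy–Schwarz: `1`). See the module docstring. [folklore] -/
theorem abs_integral_stretching_le_strainCube (hv : ContDiff ℝ ∞ v) (hdiv : VectorCalculus.IsDivFree v)
    {M B : ℝ} (hM : ∀ x, ‖v x‖ ≤ M) (hB : ∀ x, ‖fderiv ℝ v x‖ ≤ B)
    (h0 : ∫⁻ x, ‖iteratedFDeriv ℝ 0 v x‖ₑ ^ 2 < ⊤) (h1 : ∫⁻ x, ‖iteratedFDeriv ℝ 1 v x‖ₑ ^ 2 < ⊤)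
    (h2 : ∫⁻ x, ‖iteratedFDeriv ℝ 2 v x‖ₑ ^ 2 < ⊤) :
    |∫ x, ⟪curl v x, fderiv ℝ v x (curl v x)⟫| ≤
      (Real.sqrt 3 + Real.sqrt 6) / 9 * M * Real.sqrt (∫ x, ‖curl v x‖ ^ 2) *
        Real.sqrt (∫ x, frobeniusNormSq (fderiv ℝ (curl v) x)) := by
  -- the strain
  set s : Fin 3 → Fin 3 → EuclideanSpace ℝ (Fin 3) → ℝ :=
    fun i j y => (pderiv j (fun z => v z i) y + pderiv i (fun z => v z j) y) / 2 with hsdef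
  have hs : ∀ i j y, s i j y = (pderiv j (fun z => v z i) y + pderiv i (fun z => v z j) y) / 2 :=
    fun i j y => rfl
  have hM0 : 0 ≤ M := (norm_nonneg _).trans (hM 0)
  set Z := ∫ x, ‖curl v x‖ ^ 2 with hZ
  set W := ∫ x, frobeniusNormSq (fderiv ℝ (curl v) x) with hW
  have hZ0 : 0 ≤ Z := integral_nonneg fun x => sq_nonneg _
  have hW0 : 0 ≤ W := integral_nonneg fun x => frobeniusNormSq_nonneg _
  -- (1)+(2): `|J| ≤ (2√6/9) ∫|S|³`
  have hA := abs_integral_stretching_le_integral_cube hv hdiv hM hB h1 hs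
  -- (3): the cube interpolation
  have hI := integral_strainCube_le hv hdiv hM hB h1 h2 hs
  -- (4): the `L²` identities
  have e1 : ∫ x, ∑ i, ∑ j, s i j x ^ 2 = (1 / 2) * Z := integral_sumSq_sym_eq_half hv hdiv h0 h1 hs
  have e2 : ∫ x, ∑ l, ∑ i, ∑ j, pderiv l (s i j) x ^ 2 = (1 / 2) * W :=
    integral_gradSq_sym_eq_half hv hdiv h1 h2 hs
  have e3 : ∫ x, ‖(Δ v) x‖ ^ 2 = W := integral_norm_laplacian_sq_eq hv hdiv h1 h2
  rw [e1, e2, e3] at hI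
  have hc : 0 ≤ (2 / 9) * Real.sqrt 6 := by positivity
  calc |∫ x, ⟪curl v x, fderiv ℝ v x (curl v x)⟫|
      ≤ (2 / 9) * Real.sqrt 6 * ∫ x, (∑ i, ∑ j, s i j x ^ 2) * Real.sqrt (∑ i, ∑ j, s i j x ^ 2) := hA
    _ ≤ (2 / 9) * Real.sqrt 6 * (M * ((1 / 2) * Real.sqrt W * Real.sqrt ((1 / 2) * Z) +
          Real.sqrt ((1 / 2) * Z) * Real.sqrt ((1 / 2) * W))) := mul_le_mul_of_nonneg_left hI hc
    _ = (Real.sqrt 3 + Real.sqrt 6) / 9 * M * Real.sqrt Z * Real.sqrt W := by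
        rw [show (2 / 9) * Real.sqrt 6 * (M * ((1 / 2) * Real.sqrt W * Real.sqrt ((1 / 2) * Z) +
            Real.sqrt ((1 / 2) * Z) * Real.sqrt ((1 / 2) * W))) =
            M * ((2 / 9) * Real.sqrt 6 * ((1 / 2) * Real.sqrt W * Real.sqrt ((1 / 2) * Z) +
            Real.sqrt ((1 / 2) * Z) * Real.sqrt ((1 / 2) * W))) by ring, depletion_constant_eq Z W]
        ring

/-- `(√3 + √6)/9 < 1/2` (so the constant closes RUNG TWO). [folklore] -/
theorem depletion_constant_lt_half : (Real.sqrt 3 + Real.sqrt 6) / 9 < 1 / 2 := by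
  have h3 : Real.sqrt 3 < 7 / 4 := by
    rw [Real.sqrt_lt' (by norm_num)]; norm_num
  have h6 : Real.sqrt 6 < 5 / 2 := by
    rw [Real.sqrt_lt' (by norm_num)]; norm_num
  linarith

end Summit.NavierStokesRegularity.NavierStokesRegularity.Theorems.DepletionLadder.StrainCube

end
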